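import Summits.QuantumFields.YangMills.Theorems.DirichletWindowXiDiverges

/-!
# `XiDiverges` (item stmt-QuantumFields-8941): the logarithmic window and the ratio form

Support file for the statement item stmt-QuantumFields-8941,
`Summit.QuantumFields.YangMills.Theses.DirichletWindow.XiDiverges` ("ξ_lat(β) → ∞ uniformly over
infinite-volume torus-limit states", Chatterjee's Problem 5.1, second half), continuing
`DirichletWindowXiDiverges.lean` (chord lemma, one-scale window, and the doors
`FixedDistanceLower ∧ PlaquetteVarianceUpper`, `PolynomialWindow`, `XiExpLowerBound`).

* `xiDiverges_of_logWindow` — a THIRD sufficient window, incomparable with those doors: given the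
  reflection-positivity half `AxialLogConvexity`, `XiDiverges` follows from a lower bound
  `A/(β^p n^k)` at SOME separation `n ≥ C log β`, for every `C`, eventually in `β`, in every limit
  state. No variance bound (item 8939) is used and the `β`-orders of the lower bound and of
  `f_μ(e₀)` need not match — any polynomial loss in `β` is absorbed by the logarithmic reach of
  the window. (With `FixedDistanceLower`, which is pointwise in `n`, the orders MUST match, whence
  `PlaquetteVarianceUpper`; `PolynomialWindow` reaches `β^p ≫ C log β`:
  `logWindow_of_polynomialWindow`.)
* `xiDiverges_iff_eventually_ratio` — what the item IS, given `AxialLogConvexity`: for every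
  `ε > 0`, eventually in `β`, in every limit state the successive ratios `f_μ((n+1)e₀)/f_μ(n e₀)`
  are eventually `≥ e^{-ε}` — the reflection-positivity axial mass of every limit state tends to
  `0` as `β → ∞`, uniformly in the state.

The weak-coupling input itself (any of the windows) is the open content of items 8935–8939 and is
not touched here; no definition is introduced.

References: S. Chatterjee, arXiv:1803.01950, Problem 5.1; E. Seiler, LNP 159 (1982) Ch. 2
(reflection positivity, log-convexity of two-point functions); J. Glimm, A. Jaffe, Quantum Physics
(1987) §6 (spectral/transfer-matrix form of RP two-point functions).
-/

namespace Summit.QuantumFields.YangMills.Theorems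

open Real Filter Asymptotics
open Literature.MathematicalPhysics.QuantumFieldTheory Literature.MathematicalPhysics.QuantumLattice

/-- **Logarithmic window ⇒ `XiDiverges` (no variance bound, any polynomial loss in `β`).**
Assume the reflection-positivity half `AxialLogConvexity`. Then `XiDiverges` follows as soon as,
for every compact simple `G` and every `r`, there is an exponent `p` such that for EVERY `C`,
eventually in `β`, every limit state `μ` has SOME separation `n ≥ C log β` at which
`f_μ(n e₀) ≥ A/(β^p n^k)` (`A > 0`, `k` allowed to depend on `C`). Compared with the chord glue
`xiDiverges_of_fixedDistanceLower` no upper bound on the variance is needed (only `f_μ(e₀) ≤ N²`)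
and the orders in `β` need not match: the price is that the separation must reach `C log β` for
every `C` (for `XiDiverges` at rate `ε` one uses `C = (p+1)/ε`). `PolynomialWindow`
(`n ≤ β^p`) is the special case of a much longer window. Proof: with `ε C = p + 1`,
`β^p ≤ e^{(ε - ε/(p+1)) n}`, so `e^{-ε (n-1)} N² ≤ A/(β^p n^k)` reduces to
`N² e^{ε} n^k ≤ A e^{ε n/(p+1)}`, true for `n` large, i.e. for `β` large. [folklore] -/
theorem xiDiverges_of_logWindow
    (hRP : Theses.DirichletWindow.AxialLogConvexity)
    (hW : ∀ (G : Type) [Group G] [TopologicalSpace G] [IsTopologicalGroup G] [CompactSpace G]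
      [MeasurableSpace G] [BorelSpace G], IsCompactSimpleLieGroup G → ∀ r : LatticeRep G,
      ∃ p : ℕ, ∀ C : ℝ, ∃ A : ℝ, ∃ k : ℕ, ∃ β₁ : ℝ, 0 < A ∧ ∀ β : ℝ, β₁ ≤ β →
        ∀ μ ∈ infiniteVolumeLimitPoints (d := 4) r.ρ β, ∃ n : ℕ,
          C * Real.log β ≤ n ∧
          A / (β ^ p * (n : ℝ) ^ k) ≤
            plaquetteCorrFn r.ρ μ ((n : ℤ) • Pi.single (0 : Fin 4) (1 : ℤ))) :
    Theses.DirichletWindow.XiDiverges := by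
  refine xiDiverges_of_window hRP fun G _ _ _ _ _ _ hG r ε hε => ?_
  obtain ⟨p, hp⟩ := hW G hG r
  -- window constant `C` with `ε C = p + 1`, and the spare rate `δ = ε / (p + 1)`
  set C : ℝ := ((p : ℝ) + 1) / ε with hC
  have hCpos : 0 < C := by positivity
  set δ : ℝ := ε / ((p : ℝ) + 1) with hδ
  have hδpos : 0 < δ := by positivity
  have hpC : (p : ℝ) / C = ε - δ := by
    rw [hC, hδ]
    field_simp
    ring
  obtain ⟨A, k, β₁, hA, hW'⟩ := hp C
  -- threshold in the separation: `(N² + 1) e^{ε} x^k ≤ A e^{δ x}` eventually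
  have hev : ∀ᶠ x : ℝ in atTop,
      ((r.N : ℝ) ^ 2 + 1) * Real.exp ε * x ^ k ≤ A * Real.exp (δ * x) := by
    have hc : 0 < A / (((r.N : ℝ) ^ 2 + 1) * Real.exp ε) := by positivity
    filter_upwards [(isLittleO_pow_exp_pos_mul_atTop k hδpos).def hc, eventually_ge_atTop (0 : ℝ)]
      with x hx hx0
    rw [Real.norm_of_nonneg (pow_nonneg hx0 _), Real.norm_of_nonneg (Real.exp_pos _).le] at hx
    calc ((r.N : ℝ) ^ 2 + 1) * Real.exp ε * x ^ k
        ≤ ((r.N : ℝ) ^ 2 + 1) * Real.exp ε *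
            (A / (((r.N : ℝ) ^ 2 + 1) * Real.exp ε) * Real.exp (δ * x)) :=
          mul_le_mul_of_nonneg_left hx (by positivity)
      _ = A * Real.exp (δ * x) := by
          field_simp
  obtain ⟨n₁, hn₁⟩ :=
    ((tendsto_natCast_atTop_atTop.eventually hev).and (eventually_ge_atTop 2)).exists_forall_of_atTop
  -- threshold in `β`: `C log β ≥ n₁` and `β ≥ max β₁ 1`
  have hlog : Tendsto (fun β : ℝ => C * Real.log β) atTop atTop :=
    Real.tendsto_log_atTop.const_mul_atTop hCpos
  obtain ⟨β₂, hβ₂⟩ := ((hlog.eventually_ge_atTop (n₁ : ℝ)).and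
    (eventually_ge_atTop (max β₁ 1))).exists_forall_of_atTop
  refine ⟨β₂, fun β hβ μ hμ => ?_⟩
  obtain ⟨hβn₁, hβm⟩ := hβ₂ β hβ
  have hββ₁ : β₁ ≤ β := (le_max_left _ _).trans hβm
  have hβ1 : 1 ≤ β := (le_max_right _ _).trans hβm
  have hβ0 : 0 < β := one_pos.trans_le hβ1
  obtain ⟨n, hCn, hlow⟩ := hW' β hββ₁ μ hμ
  have hn₁n : n₁ ≤ n := Nat.cast_le.1 (hβn₁.trans hCn)
  obtain ⟨hbd, hn2⟩ := hn₁ n hn₁n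
  obtain ⟨M, rfl⟩ : ∃ M, n = M + 2 := ⟨n - 2, by omega⟩
  refine ⟨M, ?_⟩
  have hRP' := hRP G hG r β hβ0.le μ hμ
  have hAq : (0 : ℝ) < A / (β ^ p * ((M + 2 : ℕ) : ℝ) ^ k) := by positivity
  have hpos := hAq.trans_le hlow
  refine ⟨hpos, ?_⟩
  have h1N := (hRP' 1).2.2.1
  -- `β^p ≤ e^{(ε - δ) n}` because `log β ≤ n / C` and `p / C = ε - δ`
  have hβp : β ^ p ≤ Real.exp ((ε - δ) * ((M + 2 : ℕ) : ℝ)) := by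
    have hlogβ : Real.log β ≤ ((M + 2 : ℕ) : ℝ) / C := by
      rw [le_div_iff₀ hCpos, mul_comm]
      exact hCn
    calc β ^ p = Real.exp (Real.log (β ^ p)) := (Real.exp_log (pow_pos hβ0 p)).symm
      _ = Real.exp ((p : ℝ) * Real.log β) := by rw [Real.log_pow]
      _ ≤ Real.exp ((p : ℝ) * (((M + 2 : ℕ) : ℝ) / C)) := by
          gcongr
      _ = Real.exp ((ε - δ) * ((M + 2 : ℕ) : ℝ)) := by
          rw [← hpC]
          congr 1
          field_simp
  have hexp : Real.exp (-(ε * (M + 1))) * Real.exp ((ε - δ) * ((M + 2 : ℕ) : ℝ)) =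
      Real.exp ε * Real.exp (-(δ * ((M + 2 : ℕ) : ℝ))) := by
    rw [← Real.exp_add, ← Real.exp_add]
    congr 1
    push_cast
    ring
  have hone : Real.exp (δ * ((M + 2 : ℕ) : ℝ)) * Real.exp (-(δ * ((M + 2 : ℕ) : ℝ))) = 1 := by
    rw [← Real.exp_add, add_neg_cancel, Real.exp_zero]
  -- the real-variable bookkeeping `e^{-ε (M+1)} N² ≤ A/(β^p (M+2)^k)`
  have harith : Real.exp (-(ε * (M + 1))) * (r.N : ℝ) ^ 2 ≤
      A / (β ^ p * ((M + 2 : ℕ) : ℝ) ^ k) := by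
    rw [le_div_iff₀ (by positivity)]
    calc Real.exp (-(ε * (M + 1))) * (r.N : ℝ) ^ 2 * (β ^ p * ((M + 2 : ℕ) : ℝ) ^ k)
        ≤ Real.exp (-(ε * (M + 1))) * (r.N : ℝ) ^ 2 *
            (Real.exp ((ε - δ) * ((M + 2 : ℕ) : ℝ)) * ((M + 2 : ℕ) : ℝ) ^ k) := by
          gcongr
      _ = (r.N : ℝ) ^ 2 * ((M + 2 : ℕ) : ℝ) ^ k *
            (Real.exp (-(ε * (M + 1))) * Real.exp ((ε - δ) * ((M + 2 : ℕ) : ℝ))) := by ring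
      _ = (r.N : ℝ) ^ 2 * Real.exp ε * ((M + 2 : ℕ) : ℝ) ^ k *
            Real.exp (-(δ * ((M + 2 : ℕ) : ℝ))) := by rw [hexp]; ring
      _ ≤ ((r.N : ℝ) ^ 2 + 1) * Real.exp ε * ((M + 2 : ℕ) : ℝ) ^ k *
            Real.exp (-(δ * ((M + 2 : ℕ) : ℝ))) := by
          gcongr
          linarith
      _ ≤ A * Real.exp (δ * ((M + 2 : ℕ) : ℝ)) * Real.exp (-(δ * ((M + 2 : ℕ) : ℝ))) :=
          mul_le_mul_of_nonneg_right hbd (Real.exp_pos _).le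
      _ = A := by rw [mul_assoc, hone, mul_one]
  have hfin := (mul_le_mul_of_nonneg_left h1N (Real.exp_pos (-(ε * (M + 1)))).le).trans
    (harith.trans hlow)
  exact hfin

/-- **`XiDiverges` is the uniform vanishing of the axial mass.** Under the reflection-positivity
half `AxialLogConvexity` (which makes the ratios `f_μ((n+1)e₀)/f_μ(n e₀)` non-decreasing in
`n ≥ 1` wherever the two-point function is positive), `XiDiverges` is equivalent to: for every
`ε > 0`, eventually in `β`, in EVERY limit state the axial two-point function is positive at some
separation `n₀` and from `n₀` on its successive ratios are at least `e^{-ε}` — i.e. the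
reflection-positivity mass `m(μ) = -lim_n log (f_μ((n+1)e₀)/f_μ(n e₀))` of every limit state at
inverse coupling `β` tends to `0` as `β → ∞`, uniformly in the state. (`→`: `XiDiverges` at
`ε/2` and ratio monotonicity — if every ratio were `< e^{-ε}` then
`A e^{-ε n/2} ≤ f_μ(n e₀) ≤ e^{-ε (n-1)} f_μ(e₀)` for all `n`, absurd; `←`: rate `m := ε`,
amplitude `A := f_μ(n₀ e₀)`, monotonicity below `n₀`.) [folklore] -/
theorem xiDiverges_iff_eventually_ratio (hRP : Theses.DirichletWindow.AxialLogConvexity) :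
    Theses.DirichletWindow.XiDiverges ↔
    ∀ (G : Type) [Group G] [TopologicalSpace G] [IsTopologicalGroup G] [CompactSpace G]
      [MeasurableSpace G] [BorelSpace G], IsCompactSimpleLieGroup G → ∀ r : LatticeRep G,
      ∀ ε : ℝ, 0 < ε → ∃ β₁ : ℝ, ∀ β : ℝ, β₁ ≤ β →
        ∀ μ ∈ infiniteVolumeLimitPoints (d := 4) r.ρ β, ∃ n₀ : ℕ,
          0 < plaquetteCorrFn r.ρ μ ((n₀ : ℤ) • Pi.single (0 : Fin 4) (1 : ℤ)) ∧
          ∀ n : ℕ, n₀ ≤ n →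
            Real.exp (-ε) * plaquetteCorrFn r.ρ μ ((n : ℤ) • Pi.single (0 : Fin 4) (1 : ℤ)) ≤
              plaquetteCorrFn r.ρ μ (((n + 1 : ℕ) : ℤ) • Pi.single (0 : Fin 4) (1 : ℤ)) := by
  constructor
  · intro hX G _ _ _ _ _ _ hG r ε hε
    obtain ⟨β₁, hβ₁⟩ := hX G hG r (ε / 2) (half_pos hε)
    refine ⟨max β₁ 0, fun β hβ μ hμ => ?_⟩
    have hβ0 : 0 ≤ β := le_of_max_le_right hβ
    obtain ⟨m, A, hA, hm0, hmε, hlow⟩ := hβ₁ β (le_of_max_le_left hβ) μ hμ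
    have hRP' := hRP G hG r β hβ0 μ hμ
    -- abbreviate the axial two-point function (kept folded through `ha`)
    set a : ℕ → ℝ := fun k => plaquetteCorrFn r.ρ μ ((k : ℤ) • Pi.single (0 : Fin 4) (1 : ℤ))
      with ha
    have hlow' : ∀ n : ℕ, A * Real.exp (-(m * n)) ≤ a n := fun n => hlow n
    have hlc : ∀ n : ℕ, a (n + 2) ^ 2 ≤ a (n + 1) * a (n + 3) := fun n => (hRP' n).2.2.2
    have hpos : ∀ n : ℕ, 0 < a n := fun n => (mul_pos hA (Real.exp_pos _)).trans_le (hlow' n)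
    -- the ratios `a (j+2) / a (j+1)` are non-decreasing
    have hr_mono : Monotone fun j => a (j + 2) / a (j + 1) := by
      refine monotone_nat_of_le_succ fun j => ?_
      show a (j + 2) / a (j + 1) ≤ a (j + 1 + 2) / a (j + 1 + 1)
      rw [div_le_div_iff₀ (hpos (j + 1)) (hpos (j + 1 + 1))]
      have h := hlc j
      nlinarith [h]
    -- some ratio is at least `e^{-ε}`
    have hex : ∃ j : ℕ, Real.exp (-ε) * a (j + 1) ≤ a (j + 2) := by
      by_contra hcon
      push Not at hcon
      -- then `a (j+1) ≤ e^{-ε j} a 1` for all `j`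
      have hup : ∀ j : ℕ, a (j + 1) ≤ Real.exp (-(ε * j)) * a 1 := by
        intro j
        induction j with
        | zero => simp
        | succ j ih =>
          calc a (j + 1 + 1) = a (j + 2) := rfl
            _ ≤ Real.exp (-ε) * a (j + 1) := (hcon j).le
            _ ≤ Real.exp (-ε) * (Real.exp (-(ε * j)) * a 1) :=
                mul_le_mul_of_nonneg_left ih (Real.exp_pos _).le
            _ = Real.exp (-(ε * ((j + 1 : ℕ) : ℝ))) * a 1 := by
                rw [← mul_assoc, ← Real.exp_add]
                congr 1
                push_cast
                ring_nf
      -- against the lower bound `A e^{-(ε/2)(j+1)} ≤ a (j+1)`: `A ≤ a 1 e^{ε/2} e^{-(ε/2) j}`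
      have hsq : ∀ j : ℕ, A ≤ a 1 * Real.exp (ε / 2) * Real.exp (-(ε / 2 * j)) := by
        intro j
        have h1 : A * Real.exp (-(m * ((j + 1 : ℕ) : ℝ))) ≤ Real.exp (-(ε * j)) * a 1 :=
          (hlow' (j + 1)).trans (hup j)
        have h2 : Real.exp (-(ε / 2 * ((j + 1 : ℕ) : ℝ))) ≤ Real.exp (-(m * ((j + 1 : ℕ) : ℝ))) := by
          refine Real.exp_le_exp.2 (neg_le_neg ?_)
          exact mul_le_mul_of_nonneg_right hmε (Nat.cast_nonneg _)
        have h3 : A * Real.exp (-(ε / 2 * ((j + 1 : ℕ) : ℝ))) ≤ Real.exp (-(ε * j)) * a 1 :=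
          (mul_le_mul_of_nonneg_left h2 hA.le).trans h1
        have h4 : Real.exp (-(ε * j)) * a 1 =
            a 1 * Real.exp (ε / 2) * Real.exp (-(ε / 2 * j)) *
              Real.exp (-(ε / 2 * ((j + 1 : ℕ) : ℝ))) := by
          rw [mul_assoc, mul_assoc, ← Real.exp_add, ← Real.exp_add]
          rw [mul_comm]
          congr 2
          push_cast
          ring
        rw [h4] at h3
        exact le_of_mul_le_mul_right h3 (Real.exp_pos _)
      have hlim : Tendsto (fun j : ℕ => a 1 * Real.exp (ε / 2) * Real.exp (-(ε / 2 * j)))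
          atTop (nhds (a 1 * Real.exp (ε / 2) * 0)) := by
        refine tendsto_const_nhds.mul ?_
        exact Real.tendsto_exp_neg_atTop_nhds_zero.comp
          (tendsto_natCast_atTop_atTop.const_mul_atTop (half_pos hε))
      rw [mul_zero] at hlim
      obtain ⟨j, hj⟩ := (hlim.eventually (gt_mem_nhds hA)).exists
      exact absurd (hsq j) (not_le.2 hj)
    obtain ⟨j, hj⟩ := hex
    refine ⟨j + 1, hpos (j + 1), fun n hn => ?_⟩
    obtain ⟨i, rfl⟩ : ∃ i, n = i + 1 := ⟨n - 1, by omega⟩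
    have hji : j ≤ i := by omega
    have hri : Real.exp (-ε) ≤ a (i + 2) / a (i + 1) := by
      have hrj : Real.exp (-ε) ≤ a (j + 2) / a (j + 1) := by
        rw [le_div_iff₀ (hpos (j + 1))]
        exact hj
      exact hrj.trans (hr_mono hji)
    have hfin : Real.exp (-ε) * a (i + 1) ≤ a (i + 1 + 1) := by
      rw [le_div_iff₀ (hpos (i + 1))] at hri
      exact hri
    exact hfin
  · intro hR G _ _ _ _ _ _ hG r ε hε
    obtain ⟨β₁, hβ₁⟩ := hR G hG r ε hε
    refine ⟨max β₁ 0, fun β hβ μ hμ => ?_⟩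
    have hβ0 : 0 ≤ β := le_of_max_le_right hβ
    obtain ⟨n₀, hpos₀, hrat⟩ := hβ₁ β (le_of_max_le_left hβ) μ hμ
    have hRP' := hRP G hG r β hβ0 μ hμ
    set a : ℕ → ℝ := fun k => plaquetteCorrFn r.ρ μ ((k : ℤ) • Pi.single (0 : Fin 4) (1 : ℤ))
      with ha
    have hmono : ∀ n : ℕ, a (n + 1) ≤ a n := fun n => (hRP' n).2.1
    have hanti : Antitone a := antitone_nat_of_succ_le hmono
    have hrat' : ∀ n : ℕ, n₀ ≤ n → Real.exp (-ε) * a n ≤ a (n + 1) := fun n hn => hrat n hn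
    have hpos₀' : 0 < a n₀ := hpos₀
    refine ⟨ε, a n₀, hpos₀', hε.le, le_rfl, ?_⟩
    -- beyond `n₀`: the ratios
    have hup : ∀ i : ℕ, a n₀ * Real.exp (-(ε * i)) ≤ a (n₀ + i) := by
      intro i
      induction i with
      | zero => simp
      | succ i ih =>
        calc a n₀ * Real.exp (-(ε * ((i + 1 : ℕ) : ℝ)))
            = Real.exp (-ε) * (a n₀ * Real.exp (-(ε * i))) := by
              push_cast
              rw [show -(ε * ((i : ℝ) + 1)) = -ε + -(ε * i) by ring, Real.exp_add]
              ring
          _ ≤ Real.exp (-ε) * a (n₀ + i) := mul_le_mul_of_nonneg_left ih (Real.exp_pos _).le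
          _ ≤ a (n₀ + i + 1) := hrat' (n₀ + i) (Nat.le_add_right _ _)
    intro n
    show a n₀ * Real.exp (-(ε * n)) ≤ a n
    rcases le_or_gt n n₀ with hn | hn
    · calc a n₀ * Real.exp (-(ε * n)) ≤ a n₀ * 1 := by
            refine mul_le_mul_of_nonneg_left ?_ hpos₀'.le
            rw [Real.exp_le_one_iff]
            nlinarith [hε, (Nat.cast_nonneg n : (0 : ℝ) ≤ n)]
        _ = a n₀ := mul_one _
        _ ≤ a n := hanti hn
    · obtain ⟨i, rfl⟩ : ∃ i, n = n₀ + i := ⟨n - n₀, by omega⟩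
      calc a n₀ * Real.exp (-(ε * ((n₀ + i : ℕ) : ℝ)))
          ≤ a n₀ * Real.exp (-(ε * i)) := by
            refine mul_le_mul_of_nonneg_left (Real.exp_le_exp.2 ?_) hpos₀'.le
            push_cast
            nlinarith [hε, (Nat.cast_nonneg n₀ : (0 : ℝ) ≤ n₀), (Nat.cast_nonneg i : (0 : ℝ) ≤ i)]
        _ ≤ a (n₀ + i) := hup i

/-- **`PolynomialWindow` is a (much longer) logarithmic window**: route `XiCompleteMonotonicity`'s
crux `PolynomialWindow` (the leading-order lower bound `A/(β² n⁸)` for all `n₀ ≤ n ≤ β^p`) supplies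
the hypothesis of `xiDiverges_of_logWindow` with exponents `(2, 8)`: given `C`, the separation
`n := max n₀ ⌈C log β⌉₊` lies in `[C log β, β^p]` for all large `β` (`log β = o(β^p)`). So
`xiDiverges_of_polynomialWindow` factors through the logarithmic window. [folklore] -/
theorem logWindow_of_polynomialWindow (hP : Theses.XiCompleteMonotonicity.PolynomialWindow) :
    ∀ (G : Type) [Group G] [TopologicalSpace G] [IsTopologicalGroup G] [CompactSpace G]
      [MeasurableSpace G] [BorelSpace G], IsCompactSimpleLieGroup G → ∀ r : LatticeRep G,
      ∃ p : ℕ, ∀ C : ℝ, ∃ A : ℝ, ∃ k : ℕ, ∃ β₁ : ℝ, 0 < A ∧ ∀ β : ℝ, β₁ ≤ β →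
        ∀ μ ∈ infiniteVolumeLimitPoints (d := 4) r.ρ β, ∃ n : ℕ,
          C * Real.log β ≤ n ∧
          A / (β ^ p * (n : ℝ) ^ k) ≤
            plaquetteCorrFn r.ρ μ ((n : ℤ) • Pi.single (0 : Fin 4) (1 : ℤ)) := by
  intro G _ _ _ _ _ _ hG r
  obtain ⟨β₀, p, A, n₀, hp, hA, hP'⟩ := hP G hG r
  refine ⟨2, fun C => ⟨A, 8, ?_⟩⟩
  -- eventually in `β`: `C log β + 1 ≤ β^p`, `n₀ ≤ β^p` and `β ≥ β₀`
  have h1 : ∀ᶠ β : ℝ in atTop, C * Real.log β + 1 ≤ β ^ p := by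
    have hc : (0 : ℝ) < 1 / (2 * (|C| + 1)) := by positivity
    filter_upwards [(isLittleO_log_rpow_atTop hp).def hc,
      (tendsto_rpow_atTop hp).eventually_ge_atTop (2 : ℝ), eventually_ge_atTop (1 : ℝ)]
      with β hβ hβ2 hβ1
    rw [Real.norm_of_nonneg (Real.log_nonneg hβ1),
      Real.norm_of_nonneg (Real.rpow_nonneg (zero_le_one.trans hβ1) _)] at hβ
    have e1 : C * Real.log β ≤ |C| * Real.log β :=
      mul_le_mul_of_nonneg_right (le_abs_self C) (Real.log_nonneg hβ1)
    have e2 : |C| * Real.log β ≤ |C| * (1 / (2 * (|C| + 1)) * β ^ p) :=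
      mul_le_mul_of_nonneg_left hβ (abs_nonneg C)
    have e3 : |C| * (1 / (2 * (|C| + 1)) * β ^ p) ≤ β ^ p / 2 := by
      rw [show |C| * (1 / (2 * (|C| + 1)) * β ^ p) = |C| / (|C| + 1) * (β ^ p / 2) by
        field_simp]
      have hle : |C| / (|C| + 1) ≤ 1 := by
        rw [div_le_one (by positivity)]
        linarith [abs_nonneg C]
      have hnn : 0 ≤ β ^ p / 2 := by positivity
      nlinarith [hle, hnn]
    linarith
  obtain ⟨β₁, hβ₁⟩ := (h1.and ((((tendsto_rpow_atTop hp).eventually_ge_atTop (n₀ : ℝ))).and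
    (eventually_ge_atTop β₀))).exists_forall_of_atTop
  refine ⟨β₁, hA, fun β hβ μ hμ => ?_⟩
  obtain ⟨hβa, hβb, hβc⟩ := hβ₁ β hβ
  refine ⟨max n₀ ⌈C * Real.log β⌉₊, ?_, ?_⟩
  · calc C * Real.log β ≤ ⌈C * Real.log β⌉₊ := Nat.le_ceil _
      _ ≤ ((max n₀ ⌈C * Real.log β⌉₊ : ℕ) : ℝ) := by exact_mod_cast le_max_right _ _
  · have hn : ((max n₀ ⌈C * Real.log β⌉₊ : ℕ) : ℝ) ≤ β ^ p := by
      rcases le_total n₀ ⌈C * Real.log β⌉₊ with h | h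
      · rw [max_eq_right h]
        rcases le_or_gt 0 (C * Real.log β) with h0 | h0
        · have h2 := Nat.ceil_lt_add_one h0
          linarith
        · rw [Nat.ceil_eq_zero.2 h0.le, Nat.cast_zero]
          exact (Nat.cast_nonneg n₀).trans hβb
      · rw [max_eq_left h]
        exact hβb
    exact hP' β hβc μ hμ (max n₀ ⌈C * Real.log β⌉₊) (le_max_left _ _) hn

/-- **The polynomial glue factors through the logarithmic window**: a second proof of route
`XiCompleteMonotonicity`'s glue item `XiDivergesOfPolynomial`
(`AxialLogConvexity → PolynomialWindow → XiDiverges`, closed in the tree by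
`xiDivergesOfPolynomial_xiCompleteMonotonicity`) as
`xiDiverges_of_logWindow ∘ logWindow_of_polynomialWindow` (an `example`, not re-declared). [folklore] -/
example : Theses.XiCompleteMonotonicity.XiDivergesOfPolynomial := fun hRP hP =>
  xiDiverges_of_logWindow hRP (logWindow_of_polynomialWindow hP)

end Summit.QuantumFields.YangMills.Theorems
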